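import Literature.NumberTheory.Rogawski1990.ArchBouazizClassMapG        -- ★-to-be (7) F0, LH3-p04 (g7): `bzClassMapG`, `esymm3`, `chartEigG_of_mem ∕ _of_not_mem`, `boostEig_eq_mul`, `bzClassMapG_congr`
import Literature.NumberTheory.Rogawski1990.ArchBouazizChartDescent     -- ★ p851534 (LH3-p03), the `H`-twin: `exists_int_eq_add_of_coe_circleExp_eq`, `update_eq_add_angleShift_of_congr`, `update_eq_negXAt_add_angleShift_of_congr`, `…_of_congr₁₂`
import Literature.NumberTheory.Automorphic.ArchSplitPlaceStandardise      -- ★ LH3-p02 (g3): `norm_boostEig` (the moduli `eˣ, 1, e⁻ˣ` of the boost eigenvalues)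
import Literature.NumberTheory.Rogawski1990.ArchStableSumG              -- ★ p851904 (LH10-p02 (g9)): `hcSwapAt_eq_slotPerm`, `update_one_swap_mem_partnerPerms`, `slotPerm_mem_regG_iff`; brings ★ `hcSwapAt`, ★ `archRG`, `archRG_ne_zero_of_mem_regG`
import HarnessLib

/-!
# (Σ4c-G) SAME STABLE CLASS ⇒ SAME QUOTIENT `Ψ∕Φ` on the `G′`-charts: the fibres of `bzClassMapG S′` at regular points are the orbits of the STABLE Weyl moves (all slot
# permutations at the compact places, `x ↦ −x` at the split places, `2π`-shifts), and a (P)(W^st)-covariant quotient is constant on them (N8-INNER (7) «(Σ-REG-G)», files F6b∕F6c;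
# Bouaziz 1994 §5.1, Shelstad 1979 §4)

Topic `NumberTheory/Rogawski1990`; namespace `Literature.NumberTheory.Rogawski1990`.  THEOREMS ONLY (no `def`, no instance, no notation, no axiom, no named fact, no `sorry`).
Cell `pub/hodgecm-mathlib`, crux H413 (`stmt-HodgeConjecture-24833`), line LH2 (closer stub `stub_N8`, organ (Sh)′), N8-INNER road (dealer LH2-plan (g1), RULING (7) 15:59:55Z),
brick **(7) «(Σ-REG-G)»** (owner LH3-p04 (g7)), file **F6 `…ClassDescentG`**, layers (b) FIBRES + (c) QUOTIENT: the `G′`-twin of ★ `ArchBouazizClassMapFibre` §1 + ★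
`ArchBouazizChartDescent` §3–§4 (`div_eq_div_of_bzClassMap_eq`), with the compact FLIP replaced by ALL slot transpositions ★ `hcSwapAt w i j` (the stable Weyl group `S₃` of a compact
place) and Shelstad's character `R_S` by ★ `archRG`.  Author F0P3a-p04 (g27).  Count-neutral.

THE MATHEMATICS.  (b) FIBRES.  Equal elementary symmetric functions `esymm3 l = esymm3 l′` make every `l′_i` a root of `∏_j (X − l_j)` (`exists_eq_of_esymm3_eq`: evaluate
`(z − l₀)(z − l₁)(z − l₂) = z³ − e₁z² + e₂z − e₃` at `z = l′_i`), so an INJECTIVE `l′` is `l ∘ τ` for a permutation `τ` (`exists_perm_of_esymm3_eq`).  At a compact place `w ∉ S′` of a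
`G`-regular `c′` this gives `e^{i c′_{w,i}} = e^{i c_{w,τ i}}` (`exists_perm_circleExp_eq_of_bzClassMapG_apply_eq`); at a split place `w ∈ S′` (`x, x′ ≠ 0`) the moduli `eˣ, 1, e⁻ˣ` of
★ `boostEig` are pairwise distinct (★ `norm_boostEig`), so `x′ = ±x`, `e^{iφ′} = e^{iφ}`, `e^{iθ′} = e^{iθ}` (`split_coords_of_bzClassMapG_apply_eq`).
(c) QUOTIENT.  For `Ψ, Φ` satisfying (P) `Ψ (c + angleShift w i k) = Ψ c` (`w ∉ S′ ∨ i ≠ 0`) and the chart-`S′` slice of ★ `ArchHcStableWeyl` — (W^st) `Ψ (hcSwapAt w i j c) · R′(c) =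
R′(hcSwapAt w i j c) · Ψ c` (`w ∉ S′`, `i ≠ j`) and (X) `Ψ (negXAt w c) = Ψ c` (`w ∈ S′`) — the pair (`Φ ≠ 0`, `Ψ∕Φ`) is invariant under each move at a regular point (`R′ ≠ 0` on
`RegG`, ★ `archRG_ne_zero_of_mem_regG`; a transposition keeps `RegG`, ★ `slotPerm_mem_regG_iff`), under every slot PERMUTATION at a compact place (induction over transpositions,
Mathlib `Equiv.Perm.swap_induction_on`), hence under the one-place update dictated by (b), and finally — one place at a time along the regular hybrid points
`w ↦ if w ∈ T then c′ w else c w` — **`div_eq_div_of_bzClassMapG_eq`**: `c, c′ ∈ RegG S′`, `bzClassMapG S′ c = bzClassMapG S′ c′`, `Φ c ≠ 0 ⇒ Φ c′ ≠ 0 ∧ Ψ c ∕ Φ c = Ψ c′ ∕ Φ c′` —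
the (desc) input of F6a `exists_classDescentG_of_section_of_descent` with `Cov Ψ := (P) ∧ (W^st) ∧ (X)` on the chart `S′`.
HONEST LABEL: (Sh)′ ∕ row `stub_N8` stay PRINT-labelled until the N8-INNER junction is ★ and ED. 43 re-keys 27456; HC_CM is proved only modulo the 7 printed citations (2 remaining:
hLiu418 = stmt-HodgeConjecture-24832, h413 = stmt-HodgeConjecture-24833) until rung 0 closes; coordinate bookkeeping, pays nothing by itself.

## References
* [Bouaziz1994IntegralesOrbitales] A. Bouaziz, *Intégrales orbitales sur les groupes de Lie réductifs*, Ann. Sci. ÉNS (4) 27 (1994) 573–609, §2.3 p. 578, §5.1 p. 588, §6.2 p. 591.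
* [Shelstad1979] D. Shelstad, *Characters and inner forms of a quasi-split group over ℝ*, Compositio Math. 39 (1979), §4 pp. 22–25, Lemma 4.2 (p. 23).
* [Rogawski1990] J. D. Rogawski, *Automorphic Representations of Unitary Groups in Three Variables*, Ann. of Math. Stud. 123 (1990), §3.6 p. 28, §4.3 p. 42, §8.2 p. 122.
-/

set_option autoImplicit false

noncomputable section

open Complex Set Function Real
open Literature.NumberTheory.Automorphic.ArchCartan Literature.NumberTheory.Automorphic.UnitaryGroup

namespace Literature.NumberTheory.Rogawski1990

variable {W : Type*}

/-! ## §1 Fibres of `esymm3` -/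

section Esymm

/-- `(z − l₀)(z − l₁)(z − l₂) = z³ − e₁z² + e₂z − e₃` with `(e₁, e₂, e₃) = esymm3 l` (Vieta). [cite: Rogawski1990, §4.3 p. 42] -/
theorem prod_sub_eq_cubic_esymm3 (l : Fin 3 → ℂ) (z : ℂ) :
    (z - l 0) * (z - l 1) * (z - l 2) = z ^ 3 - (esymm3 l).1 * z ^ 2 + (esymm3 l).2.1 * z - (esymm3 l).2.2 := by
  rw [esymm3_apply]
  ring

/-- **Equal elementary symmetric functions ⇒ every `l′_i` is one of the `l_j`** (it is a root of the common cubic). [cite: Rogawski1990, §4.3 p. 42] [cite: Shelstad1979, §4 p. 22] -/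
theorem eq_or_eq_or_eq_of_esymm3_eq {l l' : Fin 3 → ℂ} (h : esymm3 l = esymm3 l') (i : Fin 3) : l' i = l 0 ∨ l' i = l 1 ∨ l' i = l 2 := by
  have h0 : (l' i - l 0) * (l' i - l 1) * (l' i - l 2) = 0 := by
    rw [prod_sub_eq_cubic_esymm3 l (l' i), h, ← prod_sub_eq_cubic_esymm3 l' (l' i)]
    fin_cases i <;> simp
  rcases mul_eq_zero.1 h0 with h01 | h2
  · rcases mul_eq_zero.1 h01 with h0' | h1
    · exact Or.inl (sub_eq_zero.1 h0')
    · exact Or.inr (Or.inl (sub_eq_zero.1 h1))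
  · exact Or.inr (Or.inr (sub_eq_zero.1 h2))

/-- The same as an existence statement. [cite: Rogawski1990, §4.3 p. 42] -/
theorem exists_eq_of_esymm3_eq {l l' : Fin 3 → ℂ} (h : esymm3 l = esymm3 l') (i : Fin 3) : ∃ j : Fin 3, l' i = l j := by
  rcases eq_or_eq_or_eq_of_esymm3_eq h i with h0 | h1 | h2
  · exact ⟨0, h0⟩
  · exact ⟨1, h1⟩
  · exact ⟨2, h2⟩

/-- **Equal elementary symmetric functions and `l′` injective ⇒ `l′ = l ∘ τ` for a permutation `τ`** (the eigenvalue MULTISET determines the triple up to `S₃`).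
[cite: Shelstad1979, §4 p. 22; Lemma 4.2 (p. 23)] [cite: Rogawski1990, §3.6 p. 28] -/
theorem exists_perm_of_esymm3_eq {l l' : Fin 3 → ℂ} (h : esymm3 l = esymm3 l') (hl' : Function.Injective l') :
    ∃ τ : Equiv.Perm (Fin 3), ∀ i, l' i = l (τ i) := by
  choose σ hσ using exists_eq_of_esymm3_eq h
  have hinj : Function.Injective σ := fun i j hij => hl' (by rw [hσ i, hσ j, hij])
  exact ⟨Equiv.ofBijective σ (Finite.injective_iff_bijective.1 hinj), fun i => hσ i⟩

end Esymm

/-! ## §2 Fibres of `bzClassMapG S′` at one place -/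

section Fibre

variable [DecidableEq W] (S' : Finset W)

/-- **COMPACT PLACE: the fibre is an `S₃`-orbit mod `2π`.**  At `w ∉ S′`, if `c′` has pairwise distinct unit eigenvalues at `w` (as every point of ★ `RegG S′` does) and the same class
datum as `c`, then `e^{i c′_{w,i}} = e^{i c_{w, τ i}}` for a slot permutation `τ`. [cite: Shelstad1979, Lemma 4.2 (p. 23)] [cite: Bouaziz1994IntegralesOrbitales, §5.1 p. 588] -/
theorem exists_perm_circleExp_eq_of_bzClassMapG_apply_eq {w : W} (hw : w ∉ S') {c c' : W → Fin 3 → ℝ}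
    (hc' : Function.Injective fun i : Fin 3 => Circle.exp (c' w i)) (h : bzClassMapG S' c w = bzClassMapG S' c' w) :
    ∃ τ : Equiv.Perm (Fin 3), ∀ i, Circle.exp (c' w i) = Circle.exp (c w (τ i)) := by
  rw [bzClassMapG_apply, bzClassMapG_apply, chartEigG_of_not_mem hw, chartEigG_of_not_mem hw] at h
  have hinj : Function.Injective fun i : Fin 3 => Complex.exp ((c' w i : ℂ) * I) := by
    intro i j hij
    apply hc'
    apply Circle.ext
    have hij' : Complex.exp ((c' w i : ℂ) * I) = Complex.exp ((c' w j : ℂ) * I) := hij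
    rw [Circle.coe_exp, Circle.coe_exp]
    exact hij'
  obtain ⟨τ, hτ⟩ := exists_perm_of_esymm3_eq h hinj
  refine ⟨τ, fun i => Circle.ext ?_⟩
  rw [Circle.coe_exp, Circle.coe_exp]
  exact hτ i

/-- **SPLIT PLACE: the fibre is `{±x} × (angles mod 2π)`.**  At `w ∈ S′` with `x = c_{w,0} ≠ 0 ≠ x′ = c′_{w,0}`, equal class data force `x′ = ±x`, `e^{iφ′} = e^{iφ}`, `e^{iθ′} = e^{iθ}`
(the moduli `eˣ, 1, e⁻ˣ` of the boost eigenvalues are pairwise distinct). [cite: Shelstad1979, §4 p. 23] [cite: Rogawski1990, §3.6 p. 28; §4.3 p. 42] -/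
theorem split_coords_of_bzClassMapG_apply_eq {w : W} (hw : w ∈ S') {c c' : W → Fin 3 → ℝ} (hx : c w 0 ≠ 0) (hx' : c' w 0 ≠ 0)
    (h : bzClassMapG S' c w = bzClassMapG S' c' w) :
    (c' w 0 = c w 0 ∨ c' w 0 = -(c w 0)) ∧ Circle.exp (c' w 1) = Circle.exp (c w 1) ∧ Circle.exp (c' w 2) = Circle.exp (c w 2) := by
  rw [bzClassMapG_apply, bzClassMapG_apply, chartEigG_of_mem hw, chartEigG_of_mem hw] at h
  obtain ⟨n0, n1, n2⟩ := norm_boostEig (c w)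
  obtain ⟨n0', n1', -⟩ := norm_boostEig (c' w)
  have hx1 : Real.exp (c w 0) ≠ 1 := by rw [Ne, Real.exp_eq_one_iff]; exact hx
  have hx2 : Real.exp (-(c w 0)) ≠ 1 := by rw [Ne, Real.exp_eq_one_iff, neg_eq_zero]; exact hx
  have hx1' : Real.exp (c' w 0) ≠ 1 := by rw [Ne, Real.exp_eq_one_iff]; exact hx'
  -- the three eigenvalues as explicit products
  have e0 : boostEig (c w) 0 = Complex.exp (c w 0 : ℂ) * Complex.exp ((c w 2 : ℂ) * I) := by rw [boostEig_eq_mul]; rfl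
  have e1 : boostEig (c w) 1 = Complex.exp ((c w 1 : ℂ) * I) := by rw [boostEig_eq_mul]; rfl
  have e2 : boostEig (c w) 2 = Complex.exp (-(c w 0 : ℂ)) * Complex.exp ((c w 2 : ℂ) * I) := by rw [boostEig_eq_mul]; rfl
  have e0' : boostEig (c' w) 0 = Complex.exp (c' w 0 : ℂ) * Complex.exp ((c' w 2 : ℂ) * I) := by rw [boostEig_eq_mul]; rfl
  have e1' : boostEig (c' w) 1 = Complex.exp ((c' w 1 : ℂ) * I) := by rw [boostEig_eq_mul]; rfl
  -- slot 1 (the unit eigenvalue `e^{iφ′}`) can only match slot 1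
  have hφ : Complex.exp ((c' w 1 : ℂ) * I) = Complex.exp ((c w 1 : ℂ) * I) := by
    rcases eq_or_eq_or_eq_of_esymm3_eq h 1 with hj | hj | hj
    · exact absurd (by rw [← n0, ← hj, n1']) hx1.symm
    · rw [← e1, ← e1']; exact hj
    · exact absurd (by rw [← n2, ← hj, n1']) hx2.symm
  -- slot 0 (`e^{x′+iθ′}`, modulus `e^{x′} ≠ 1`) matches slot 0 or slot 2
  have key : (c' w 0 = c w 0 ∨ c' w 0 = -(c w 0)) ∧ Complex.exp ((c' w 2 : ℂ) * I) = Complex.exp ((c w 2 : ℂ) * I) := by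
    rcases eq_or_eq_or_eq_of_esymm3_eq h 0 with hj | hj | hj
    · -- `e^{x′} e^{iθ′} = e^{x} e^{iθ}`
      have hn : Real.exp (c' w 0) = Real.exp (c w 0) := by rw [← n0', ← n0, hj]
      have hxx : c' w 0 = c w 0 := Real.exp_injective hn
      refine ⟨Or.inl hxx, ?_⟩
      rw [e0, e0', hxx] at hj
      exact mul_left_cancel₀ (Complex.exp_ne_zero _) hj
    · exact absurd (by rw [← n0', hj, n1]) hx1'
    · -- `e^{x′} e^{iθ′} = e^{−x} e^{iθ}`
      have hn : Real.exp (c' w 0) = Real.exp (-(c w 0)) := by rw [← n0', ← n2, hj]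
      have hxx : c' w 0 = -(c w 0) := Real.exp_injective hn
      refine ⟨Or.inr hxx, ?_⟩
      rw [e2, e0', hxx, Complex.ofReal_neg] at hj
      exact mul_left_cancel₀ (Complex.exp_ne_zero _) hj
  refine ⟨key.1, Circle.ext ?_, Circle.ext ?_⟩
  · rw [Circle.coe_exp, Circle.coe_exp]; exact hφ
  · rw [Circle.coe_exp, Circle.coe_exp]; exact key.2

end Fibre

/-! ## §3 Invariance of the pair (`Φ ≠ 0`, `Ψ ∕ Φ`) under the stable Weyl moves -/

section Invariance

variable [Fintype W] [DecidableEq W] (S' : Finset W) {Ψ Φ : (W → Fin 3 → ℝ) → ℂ}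

omit [Fintype W] in
/-- Under an admissible angle shift both families are unchanged. [cite: Bouaziz1994IntegralesOrbitales, §2.3 p. 578] -/
theorem quotG_invariant_angleShift
    (hΨP : ∀ (c : W → Fin 3 → ℝ) (w : W) (i : Fin 3) (k : ℤ), (w ∉ S' ∨ i ≠ 0) → Ψ (c + angleShift w i k) = Ψ c)
    (hΦP : ∀ (c : W → Fin 3 → ℝ) (w : W) (i : Fin 3) (k : ℤ), (w ∉ S' ∨ i ≠ 0) → Φ (c + angleShift w i k) = Φ c)
    {c : W → Fin 3 → ℝ} {w : W} {i : Fin 3} (hwi : w ∉ S' ∨ i ≠ 0) (k : ℤ) (hΦ : Φ c ≠ 0) :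
    Φ (c + angleShift w i k) ≠ 0 ∧ Ψ c / Φ c = Ψ (c + angleShift w i k) / Φ (c + angleShift w i k) := by
  rw [hΨP c w i k hwi, hΦP c w i k hwi]
  exact ⟨hΦ, rfl⟩

omit [Fintype W] in
/-- Under the sign change at a split place both families are unchanged. [cite: Shelstad1979, §4 p. 23] -/
theorem quotG_invariant_negXAt
    (hΨX : ∀ (c : W → Fin 3 → ℝ) (w : W), w ∈ S' → Ψ (negXAt w c) = Ψ c)
    (hΦX : ∀ (c : W → Fin 3 → ℝ) (w : W), w ∈ S' → Φ (negXAt w c) = Φ c)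
    {c : W → Fin 3 → ℝ} {w : W} (hw : w ∈ S') (hΦ : Φ c ≠ 0) :
    Φ (negXAt w c) ≠ 0 ∧ Ψ c / Φ c = Ψ (negXAt w c) / Φ (negXAt w c) := by
  rw [hΨX c w hw, hΦX c w hw]
  exact ⟨hΦ, rfl⟩

/-- A slot transposition at a compact place keeps `RegG S′` (★ `hcSwapAt_eq_slotPerm`, ★ `slotPerm_mem_regG_iff`). [cite: Shelstad1979, Lemma 4.2 (p. 23)] -/
theorem hcSwapAt_mem_regG {w : W} (hw : w ∉ S') (i j : Fin 3) {c : W → Fin 3 → ℝ} (hc : c ∈ RegG S') : hcSwapAt w i j c ∈ RegG S' := by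
  rw [hcSwapAt_eq_slotPerm]
  exact (slotPerm_mem_regG_iff (update_one_swap_mem_partnerPerms hw i j) c).2 hc

/-- **Under a slot TRANSPOSITION at a compact place** both families pick up the SAME unit `R′(swap c) ∕ R′(c)` (`R′ ≠ 0` on `RegG`, ★ `archRG_ne_zero_of_mem_regG`), so `Φ ≠ 0` persists
and the quotient is unchanged. [cite: Shelstad1979, §4 (II) p. 23; Lemma 4.2] [cite: Bouaziz1994IntegralesOrbitales, §6.2 p. 591] -/
theorem quotG_invariant_hcSwapAt
    (hΨW : ∀ (c : W → Fin 3 → ℝ) (w : W) (i j : Fin 3), w ∉ S' → i ≠ j → Ψ (hcSwapAt w i j c) * archRG S' c = archRG S' (hcSwapAt w i j c) * Ψ c)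
    (hΦW : ∀ (c : W → Fin 3 → ℝ) (w : W) (i j : Fin 3), w ∉ S' → i ≠ j → Φ (hcSwapAt w i j c) * archRG S' c = archRG S' (hcSwapAt w i j c) * Φ c)
    {c : W → Fin 3 → ℝ} {w : W} (hw : w ∉ S') {i j : Fin 3} (hij : i ≠ j) (hc : c ∈ RegG S') (hΦ : Φ c ≠ 0) :
    Φ (hcSwapAt w i j c) ≠ 0 ∧ Ψ c / Φ c = Ψ (hcSwapAt w i j c) / Φ (hcSwapAt w i j c) := by
  have hR : archRG S' c ≠ 0 := archRG_ne_zero_of_mem_regG hc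
  have hR' : archRG S' (hcSwapAt w i j c) ≠ 0 := archRG_ne_zero_of_mem_regG (hcSwapAt_mem_regG S' hw i j hc)
  have hΨ' : Ψ (hcSwapAt w i j c) = archRG S' (hcSwapAt w i j c) * Ψ c / archRG S' c := by
    rw [eq_div_iff hR]; exact hΨW c w i j hw hij
  have hΦ' : Φ (hcSwapAt w i j c) = archRG S' (hcSwapAt w i j c) * Φ c / archRG S' c := by
    rw [eq_div_iff hR]; exact hΦW c w i j hw hij
  have hΦne : Φ (hcSwapAt w i j c) ≠ 0 := by
    rw [hΦ']; exact div_ne_zero (mul_ne_zero hR' hΦ) hR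
  refine ⟨hΦne, ?_⟩
  rw [hΨ', hΦ']
  field_simp

/-- **Under EVERY slot PERMUTATION at a compact place** (`c ↦ update c w (c w ∘ τ)`, `τ ∈ S₃` = the stable Weyl group of the place) the pair (`Φ ≠ 0`, `Ψ∕Φ`) is unchanged at a
regular point — induction over transpositions (Mathlib `Equiv.Perm.swap_induction_on`), each step by `quotG_invariant_hcSwapAt`. [cite: Shelstad1979, Lemma 4.2 (p. 23)]
[cite: Bouaziz1994IntegralesOrbitales, §6.2 p. 591] -/
theorem quotG_invariant_update_comp_perm
    (hΨW : ∀ (c : W → Fin 3 → ℝ) (w : W) (i j : Fin 3), w ∉ S' → i ≠ j → Ψ (hcSwapAt w i j c) * archRG S' c = archRG S' (hcSwapAt w i j c) * Ψ c)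
    (hΦW : ∀ (c : W → Fin 3 → ℝ) (w : W) (i j : Fin 3), w ∉ S' → i ≠ j → Φ (hcSwapAt w i j c) * archRG S' c = archRG S' (hcSwapAt w i j c) * Φ c)
    {w : W} (hw : w ∉ S') (τ : Equiv.Perm (Fin 3)) :
    ∀ {c : W → Fin 3 → ℝ}, c ∈ RegG S' → Φ c ≠ 0 →
      Function.update c w (c w ∘ τ) ∈ RegG S' ∧ Φ (Function.update c w (c w ∘ τ)) ≠ 0 ∧ Ψ c / Φ c = Ψ (Function.update c w (c w ∘ τ)) / Φ (Function.update c w (c w ∘ τ)) := by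
  induction τ using Equiv.Perm.swap_induction_on with
  | one =>
    intro c hc hΦ
    rw [Equiv.Perm.coe_one, Function.comp_id, Function.update_eq_self]
    exact ⟨hc, hΦ, rfl⟩
  | swap_mul σ a b hab ih =>
    intro c hc hΦ
    -- `update c w (c w ∘ (swap a b * σ)) = update c₁ w (c₁ w ∘ σ)` with `c₁ = hcSwapAt w a b c`
    have hstep : Function.update c w (c w ∘ ⇑(Equiv.swap a b * σ)) = Function.update (hcSwapAt w a b c) w ((hcSwapAt w a b c) w ∘ σ) := by
      funext w' l
      by_cases hw' : w' = w
      · subst hw'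
        rw [Function.update_self, Function.update_self, Function.comp_apply, Function.comp_apply, hcSwapAt_apply_self, Equiv.Perm.coe_mul, Function.comp_apply]
      · rw [Function.update_of_ne hw', Function.update_of_ne hw', hcSwapAt_apply_of_ne hw']
    obtain ⟨h1Φ, h1q⟩ := quotG_invariant_hcSwapAt S' hΨW hΦW hw hab hc hΦ
    obtain ⟨h2c, h2Φ, h2q⟩ := ih (hcSwapAt_mem_regG S' hw a b hc) h1Φ
    rw [hstep]
    exact ⟨h2c, h2Φ, h1q.trans h2q⟩

end Invariance

/-! ## §4 The one-place step and the head -/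

section Descent

variable [Fintype W] [DecidableEq W] (S' : Finset W) {Ψ Φ : (W → Fin 3 → ℝ) → ℂ}

/-- **ONE-PLACE STEP**: if `c` and its update `update c w v` are `G`-regular, have the same class datum at `w`, and `Φ c ≠ 0`, then `Φ (update c w v) ≠ 0` and the quotient agrees —
the update is a composite of stable Weyl moves at `w` (§2), each preserving the pair (§3). [cite: Bouaziz1994IntegralesOrbitales, §5.1 p. 588] [cite: Shelstad1979, §4 p. 23] -/
theorem div_eq_div_update_of_bzClassMapG_apply_eq
    (hΨP : ∀ (c : W → Fin 3 → ℝ) (w : W) (i : Fin 3) (k : ℤ), (w ∉ S' ∨ i ≠ 0) → Ψ (c + angleShift w i k) = Ψ c)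
    (hΨW : ∀ (c : W → Fin 3 → ℝ) (w : W) (i j : Fin 3), w ∉ S' → i ≠ j → Ψ (hcSwapAt w i j c) * archRG S' c = archRG S' (hcSwapAt w i j c) * Ψ c)
    (hΨX : ∀ (c : W → Fin 3 → ℝ) (w : W), w ∈ S' → Ψ (negXAt w c) = Ψ c)
    (hΦP : ∀ (c : W → Fin 3 → ℝ) (w : W) (i : Fin 3) (k : ℤ), (w ∉ S' ∨ i ≠ 0) → Φ (c + angleShift w i k) = Φ c)
    (hΦW : ∀ (c : W → Fin 3 → ℝ) (w : W) (i j : Fin 3), w ∉ S' → i ≠ j → Φ (hcSwapAt w i j c) * archRG S' c = archRG S' (hcSwapAt w i j c) * Φ c)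
    (hΦX : ∀ (c : W → Fin 3 → ℝ) (w : W), w ∈ S' → Φ (negXAt w c) = Φ c)
    {c : W → Fin 3 → ℝ} (w : W) (v : Fin 3 → ℝ) (hc : c ∈ RegG S') (hcv : Function.update c w v ∈ RegG S')
    (hw : bzClassMapG S' c w = bzClassMapG S' (Function.update c w v) w) (hΦ : Φ c ≠ 0) :
    Φ (Function.update c w v) ≠ 0 ∧ Ψ c / Φ c = Ψ (Function.update c w v) / Φ (Function.update c w v) := by
  by_cases hwS : w ∈ S'
  · -- SPLIT place: `x′ = ±x`, angles congruent
    have hx : c w 0 ≠ 0 := hc.2 w hwS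
    have hxv : (Function.update c w v) w 0 ≠ 0 := hcv.2 w hwS
    obtain ⟨h0, h1, h2⟩ := split_coords_of_bzClassMapG_apply_eq S' hwS hx hxv hw
    simp only [Function.update_self] at h0 h1 h2
    obtain ⟨k₁, hk₁⟩ := exists_int_eq_add_of_coe_circleExp_eq (congrArg Subtype.val h1.symm)
    obtain ⟨k₂, hk₂⟩ := exists_int_eq_add_of_coe_circleExp_eq (congrArg Subtype.val h2.symm)
    rcases h0 with h0 | h0
    · rw [update_eq_add_angleShift_of_congr₁₂ c w v k₁ k₂ h0 hk₁ hk₂]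
      obtain ⟨h1Φ, h1q⟩ := quotG_invariant_angleShift S' hΨP hΦP (c := c) (w := w) (i := 1) (Or.inr (by decide)) k₁ hΦ
      obtain ⟨h2Φ, h2q⟩ := quotG_invariant_angleShift S' hΨP hΦP (c := c + angleShift w 1 k₁) (w := w) (i := 2) (Or.inr (by decide)) k₂ h1Φ
      exact ⟨h2Φ, h1q.trans h2q⟩
    · rw [update_eq_negXAt_add_angleShift_of_congr c w v k₁ k₂ h0 hk₁ hk₂]
      obtain ⟨h0Φ, h0q⟩ := quotG_invariant_negXAt S' hΨX hΦX (c := c) hwS hΦ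
      obtain ⟨h1Φ, h1q⟩ := quotG_invariant_angleShift S' hΨP hΦP (c := negXAt w c) (w := w) (i := 1) (Or.inr (by decide)) k₁ h0Φ
      obtain ⟨h2Φ, h2q⟩ := quotG_invariant_angleShift S' hΨP hΦP (c := negXAt w c + angleShift w 1 k₁) (w := w) (i := 2) (Or.inr (by decide)) k₂ h1Φ
      exact ⟨h2Φ, h0q.trans (h1q.trans h2q)⟩
  · -- COMPACT place: a slot permutation `τ`, then three angle shifts
    have hinj : Function.Injective fun i : Fin 3 => Circle.exp ((Function.update c w v) w i) := hcv.1 w hwS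
    obtain ⟨τ, hτ⟩ := exists_perm_circleExp_eq_of_bzClassMapG_apply_eq S' hwS hinj hw
    simp only [Function.update_self] at hτ
    -- the permuted point `d = update c w (c w ∘ τ)` and the congruences `v i = d w i + 2π k_i`
    obtain ⟨hdreg, hdΦ, hdq⟩ := quotG_invariant_update_comp_perm S' hΨW hΦW hwS τ hc hΦ
    set d := Function.update c w (c w ∘ τ) with hd
    have hdw : ∀ i, d w i = c w (τ i) := fun i => by rw [hd, Function.update_self, Function.comp_apply]
    obtain ⟨k₀, hk₀⟩ := exists_int_eq_add_of_coe_circleExp_eq (congrArg Subtype.val (hτ 0).symm)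
    obtain ⟨k₁, hk₁⟩ := exists_int_eq_add_of_coe_circleExp_eq (congrArg Subtype.val (hτ 1).symm)
    obtain ⟨k₂, hk₂⟩ := exists_int_eq_add_of_coe_circleExp_eq (congrArg Subtype.val (hτ 2).symm)
    have hupd : Function.update c w v = Function.update d w v := by rw [hd, Function.update_idem]
    rw [hupd, update_eq_add_angleShift_of_congr d w v k₀ k₁ k₂ (by rw [hdw]; exact hk₀) (by rw [hdw]; exact hk₁) (by rw [hdw]; exact hk₂)]
    obtain ⟨h0Φ, h0q⟩ := quotG_invariant_angleShift S' hΨP hΦP (c := d) (w := w) (i := 0) (Or.inl hwS) k₀ hdΦ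
    obtain ⟨h1Φ, h1q⟩ := quotG_invariant_angleShift S' hΨP hΦP (c := d + angleShift w 0 k₀) (w := w) (i := 1) (Or.inl hwS) k₁ h0Φ
    obtain ⟨h2Φ, h2q⟩ := quotG_invariant_angleShift S' hΨP hΦP (c := d + angleShift w 0 k₀ + angleShift w 1 k₁) (w := w) (i := 2) (Or.inl hwS) k₂ h1Φ
    exact ⟨h2Φ, hdq.trans (h0q.trans (h1q.trans h2q))⟩

/-- **(Σ4c-G-desc) SAME STABLE CLASS ⇒ SAME QUOTIENT `Ψ ∕ Φ`** — the (desc) input of F6a ★-to-be `exists_classDescentG_of_section_of_descent`: for `Ψ, Φ` `2π`-periodic in the angle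
slots of the chart `S′`, `S₃`-equivariant with the unit `R′(swap c)∕R′(c)` at the compact places and EVEN at the split places, and `G`-regular chart points `c, c′ ∈ RegG S′` with
`bzClassMapG S′ c = bzClassMapG S′ c′` and `Φ c ≠ 0`: `Φ c′ ≠ 0` and `Ψ c ∕ Φ c = Ψ c′ ∕ Φ c′` (place-by-place chaining of the one-place step along the hybrid points
`w ↦ if w ∈ T then c′ w else c w`, all regular since `RegG` is place-wise). [cite: Bouaziz1994IntegralesOrbitales, §5.1 p. 588; §6.2 p. 591] [cite: Shelstad1979, §4 (II) p. 23]
[cite: Rogawski1990, §3.6 p. 28] -/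
theorem div_eq_div_of_bzClassMapG_eq
    (hΨP : ∀ (c : W → Fin 3 → ℝ) (w : W) (i : Fin 3) (k : ℤ), (w ∉ S' ∨ i ≠ 0) → Ψ (c + angleShift w i k) = Ψ c)
    (hΨW : ∀ (c : W → Fin 3 → ℝ) (w : W) (i j : Fin 3), w ∉ S' → i ≠ j → Ψ (hcSwapAt w i j c) * archRG S' c = archRG S' (hcSwapAt w i j c) * Ψ c)
    (hΨX : ∀ (c : W → Fin 3 → ℝ) (w : W), w ∈ S' → Ψ (negXAt w c) = Ψ c)
    (hΦP : ∀ (c : W → Fin 3 → ℝ) (w : W) (i : Fin 3) (k : ℤ), (w ∉ S' ∨ i ≠ 0) → Φ (c + angleShift w i k) = Φ c)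
    (hΦW : ∀ (c : W → Fin 3 → ℝ) (w : W) (i j : Fin 3), w ∉ S' → i ≠ j → Φ (hcSwapAt w i j c) * archRG S' c = archRG S' (hcSwapAt w i j c) * Φ c)
    (hΦX : ∀ (c : W → Fin 3 → ℝ) (w : W), w ∈ S' → Φ (negXAt w c) = Φ c)
    {c c' : W → Fin 3 → ℝ} (hc : c ∈ RegG S') (hc' : c' ∈ RegG S') (h : bzClassMapG S' c = bzClassMapG S' c') (hΦ : Φ c ≠ 0) :
    Φ c' ≠ 0 ∧ Ψ c / Φ c = Ψ c' / Φ c' := by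
  -- the hybrid points are all regular (`RegG` is place-wise)
  have hmix : ∀ T : Finset W, (fun w => if w ∈ T then c' w else c w) ∈ RegG S' := by
    intro T
    refine ⟨fun w hw => ?_, fun w hw => ?_⟩
    · by_cases hT : w ∈ T
      · simp only [hT, if_true]; exact hc'.1 w hw
      · simp only [hT, if_false]; exact hc.1 w hw
    · by_cases hT : w ∈ T
      · simp only [hT, if_true]; exact hc'.2 w hw
      · simp only [hT, if_false]; exact hc.2 w hw
  -- induction over the places
  have key : ∀ T : Finset W, Φ (fun w => if w ∈ T then c' w else c w) ≠ 0 ∧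
      Ψ c / Φ c = Ψ (fun w => if w ∈ T then c' w else c w) / Φ (fun w => if w ∈ T then c' w else c w) := by
    intro T
    induction T using Finset.induction_on with
    | empty =>
      have h0 : (fun w => if w ∈ (∅ : Finset W) then c' w else c w) = c := funext fun w => by simp
      rw [h0]
      exact ⟨hΦ, rfl⟩
    | insert w₁ T hw₁ ih =>
      obtain ⟨ihΦ, ihq⟩ := ih
      have hupd : (fun w => if w ∈ insert w₁ T then c' w else c w) = Function.update (fun w => if w ∈ T then c' w else c w) w₁ (c' w₁) := by
        funext w
        by_cases hw : w = w₁
        · subst hw; simp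
        · simp [Finset.mem_insert, hw]
      have hcl : bzClassMapG S' (fun w => if w ∈ T then c' w else c w) w₁ =
          bzClassMapG S' (Function.update (fun w => if w ∈ T then c' w else c w) w₁ (c' w₁)) w₁ := by
        rw [bzClassMapG_congr S' (c' := c) (show (fun w => if w ∈ T then c' w else c w) w₁ = c w₁ by simp [hw₁]),
          bzClassMapG_congr S' (c' := c') (show Function.update (fun w => if w ∈ T then c' w else c w) w₁ (c' w₁) w₁ = c' w₁ by simp)]
        exact congrFun h w₁
      have hreg' : Function.update (fun w => if w ∈ T then c' w else c w) w₁ (c' w₁) ∈ RegG S' := by rw [← hupd]; exact hmix _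
      rw [hupd]
      obtain ⟨hΦ', hq'⟩ := div_eq_div_update_of_bzClassMapG_apply_eq S' hΨP hΨW hΨX hΦP hΦW hΦX w₁ (c' w₁) (hmix T) hreg' hcl ihΦ
      exact ⟨hΦ', ihq.trans hq'⟩
  have hfin : (fun w => if w ∈ (Finset.univ : Finset W) then c' w else c w) = c' := funext fun w => by simp
  simpa only [hfin] using key Finset.univ

end Descent

end Literature.NumberTheory.Rogawski1990

end
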